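import Mathlib.Analysis.Calculus.ParametricIntegral
import Mathlib.Analysis.InnerProductSpace.Calculus
import Mathlib.Analysis.Calculus.Deriv.Shift
import Summits.AtomisticToContinuum.BoseEinsteinCondensation.Theorems.BECThomsonPrincipleDensityResponseTransportedState
import Summits.AtomisticToContinuum.BoseEinsteinCondensation.Theorems.DensityResponse.Negative.PeriodisedWell

/-!
# Route `BECThomsonPrinciple`, crux `DensityResponse` (stmt-AtomisticToContinuum-9481),
# line `force-balance-constitutive` — sub-goal `stub_transportVariations` of stub S1
# (`TransportStationary`)

FIRST VARIATIONS ALONG THE TRANSPORT of the density wave and of the interaction energy. With the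
transported state `Φ^τ = Φ.transport hL hn τ` (wave function `transportFun L n τ Φ.ψ`) and the
flattened forms `m(Φ^τ) = ∫ (∑ᵢ 2cos(θᵢ + δ(τ,θᵢ))) |Φ|²`, `N_eff(Φ^τ) = ∫ (∑ᵢ 2sin²(θᵢ + δ)) |Φ|²`
of `Theorems/BECThomsonPrincipleDensityResponseTransportedState.lean`, for `L > 0`, `n ≠ 0`:

* the SOURCE VARIATION `d/dτ m(Φ^τ) = -N_eff(Φ^τ)` (`hasDerivAt_sourceMean_transport`):
  differentiation under the integral in the flattened variables with the flow equation
  `∂_τ δ = sin(θ + δ)`, dominated by `2N|Φ|²`;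
* the CONTINUITY EQUATION of the transported density, pointwise in the configuration:
  `∂_τ |Φ^τ(X)|² = -∑ᵢ [cos θᵢ |Φ^τ(X)|² + (sin θᵢ/|k|²) 2Re(conj Φ^τ(X) · k·∇ᵢΦ^τ(X))]`
  (`= -div_X(|Φ^τ|² U)`, `U = (u_k(x₁), …, u_k(x_N))`; at `τ = 0` by the chain rule for
  `h ↦ |φ(F_{-h}X)|²` and the derivative `-∑ cos θᵢ` of the squared weight, at general `τ` by the
  group law `Φ^t = (Φ^τ)^{t-τ}`);
* the INTERACTION VARIATION `d/dτ ∫_cell W |Φ^τ|² = -I_k(Φ^τ)` for a BOUNDED admissible pair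
  potential (`hasDerivAt_interaction_transport`): `W = ∑_{i<j} w^per(xᵢ - xⱼ)` is only
  measurable, so the derivative is put on `|Φ^τ|²` pointwise (dominated differentiation in the
  original variables: `W ≤ #pairs · B · |B₁|(R₀/L + 1)³` by counting lattice images,
  `periodizedPotential_sqWell_le`, and the derivative density is jointly continuous in `(τ, X)`,
  hence bounded on `[τ-1, τ+1] × cell`).

The registered sub-goal `stub_transportVariations` is the conjunction of the two variations.
Elementary calculus and measure theory; no named facts (hypervirial bookkeeping as in
Hirschfelder, J. Chem. Phys. 33 (1960) 1462). The kinetic variation is NOT in this file.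
-/

namespace Summit.AtomisticToContinuum.BoseEinsteinCondensation.Cruxes.DensityResponse.ForceBalanceConstitutive

noncomputable section

open Real MeasureTheory Filter Set Metric
open scoped ENNReal Topology ComplexConjugate
open Literature.MathematicalPhysics.QuantumManyBody.BoseGas
open Summit.AtomisticToContinuum.BoseEinsteinCondensation.Theorems.DensityResponse.Negative
  (sqWell periodizedPotential_sqWell_le ω₃ ω₃_nonneg pairCount periodicInteraction_le_of_le)

variable {N : ℕ} {L : ℝ} {n : Fin 3 → ℤ}

/-! ### The source variation `dm/dτ = -N_eff` -/

/-- Pointwise: `∂_τ [(∑ᵢ 2cos(θᵢ + δ(τ,θᵢ))) |Φ(Y)|²] = -(∑ᵢ 2sin²(θᵢ + δ(τ,θᵢ))) |Φ(Y)|²` (flow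
equation `∂_τ δ = sin(θ + δ)`). [folklore] -/
theorem hasDerivAt_sourceIntegrand (L : ℝ) (n : Fin 3 → ℤ) (ψ : Config N → ℂ) (Y : Config N)
    (t : ℝ) : HasDerivAt
      (fun t : ℝ => (∑ i, 2 * cos (phase L n Y i + angleFlow t (phase L n Y i))) * ‖ψ Y‖ ^ 2)
      (-(∑ i, 2 * sin (phase L n Y i + angleFlow t (phase L n Y i)) ^ 2) * ‖ψ Y‖ ^ 2) t := by
  refine HasDerivAt.mul_const ?_ _
  rw [← Finset.sum_neg_distrib]
  refine HasDerivAt.fun_sum fun i _ => ?_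
  have h : HasDerivAt (fun t : ℝ => 2 * cos (phase L n Y i + angleFlow t (phase L n Y i)))
      (2 * (-sin (phase L n Y i + angleFlow t (phase L n Y i)) *
        sin (phase L n Y i + angleFlow t (phase L n Y i)))) t :=
    (((hasDerivAt_angleFlow t (phase L n Y i)).const_add (phase L n Y i)).cos).const_mul 2
  refine h.congr_deriv ?_
  ring

/-- `∑ᵢ 2 sin² ≤ 2N`. [folklore] -/
theorem sum_two_mul_sin_sq_le (N : ℕ) (f : Fin N → ℝ) : ∑ i, 2 * sin (f i) ^ 2 ≤ 2 * (N : ℝ) :=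
  calc ∑ i, 2 * sin (f i) ^ 2 ≤ ∑ _i : Fin N, (2 : ℝ) :=
        Finset.sum_le_sum fun i _ => by nlinarith [sin_sq_le_one (f i)]
    _ = 2 * N := by rw [Finset.sum_const, Finset.card_univ, Fintype.card_fin, nsmul_eq_mul, mul_comm]

/-- **SOURCE VARIATION** `d/dτ m(Φ^τ) = -N_eff(Φ^τ)`: in the flattened variables only the
phases move, by the flow equation `∂_τ δ = sin(θ + δ)`; differentiation under the integral is
dominated by `2N|Φ|²`. [folklore] -/
theorem hasDerivAt_sourceMean_transport (hL : 0 < L) (hn : n ≠ 0) (Φ : PeriodicTrialState N L)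
    (τ : ℝ) : HasDerivAt (fun t : ℝ => sourceMean n (Φ.transport hL hn t))
      (-(effNumber n (Φ.transport hL hn τ))) τ := by
  have hψc : Continuous fun Y : Config N => ‖Φ.ψ Y‖ ^ 2 := (Φ.contDiff.continuous.norm).pow 2
  have hδc : ∀ (t : ℝ) (i : Fin N),
      Continuous fun Y : Config N => phase L n Y i + angleFlow t (phase L n Y i) := fun t i =>
    (continuous_phase L n i).add
      ((contDiff_angleFlow_right t (m := 0)).continuous.comp (continuous_phase L n i))
  have hbd : Continuous fun Y : Config N => 2 * (N : ℝ) * ‖Φ.ψ Y‖ ^ 2 := continuous_const.mul hψc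
  have hF : ∀ t : ℝ, Continuous fun Y : Config N =>
      (∑ i, 2 * cos (phase L n Y i + angleFlow t (phase L n Y i))) * ‖Φ.ψ Y‖ ^ 2 := fun t =>
    (continuous_finsetSum _ fun i _ => continuous_const.mul (continuous_cos.comp (hδc t i))).mul hψc
  have hF' : ∀ t : ℝ, Continuous fun Y : Config N =>
      -(∑ i, 2 * sin (phase L n Y i + angleFlow t (phase L n Y i)) ^ 2) * ‖Φ.ψ Y‖ ^ 2 := fun t =>
    (continuous_finsetSum _ fun i _ =>
      continuous_const.mul ((continuous_sin.comp (hδc t i)).pow 2)).neg.mul hψc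
  have hmain := hasDerivAt_integral_of_dominated_loc_of_deriv_le
    (μ := volume.restrict (cellN N L)) (x₀ := τ) (s := univ)
    (F := fun (t : ℝ) (Y : Config N) =>
      (∑ i, 2 * cos (phase L n Y i + angleFlow t (phase L n Y i))) * ‖Φ.ψ Y‖ ^ 2)
    (F' := fun (t : ℝ) (Y : Config N) =>
      -(∑ i, 2 * sin (phase L n Y i + angleFlow t (phase L n Y i)) ^ 2) * ‖Φ.ψ Y‖ ^ 2)
    (bound := fun Y => 2 * N * ‖Φ.ψ Y‖ ^ 2) univ_mem
    (Eventually.of_forall fun t => (hF t).aestronglyMeasurable)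
    (integrableOn_cellN (hF τ) L) (hF' τ).aestronglyMeasurable
    (Eventually.of_forall fun Y t _ => by
      rw [norm_mul, norm_neg, Real.norm_of_nonneg (Finset.sum_nonneg fun i _ => by positivity),
        Real.norm_of_nonneg (sq_nonneg _)]
      exact mul_le_mul_of_nonneg_right (sum_two_mul_sin_sq_le N _) (sq_nonneg _))
    (integrableOn_cellN hbd L)
    (Eventually.of_forall fun Y t _ => hasDerivAt_sourceIntegrand L n Φ.ψ Y t)
  have heq : (fun t : ℝ => sourceMean n (Φ.transport hL hn t)) = fun t : ℝ => ∫ Y in cellN N L,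
      (∑ i, 2 * cos (phase L n Y i + angleFlow t (phase L n Y i))) * ‖Φ.ψ Y‖ ^ 2 :=
    funext fun t => sourceMean_transport hL hn Φ t
  rw [heq, effNumber_transport hL hn Φ τ, ← integral_neg]
  simp_rw [← neg_mul]
  exact hmain.2

/-! ### The continuity equation of the transported density -/

/-- `∂_h F_{-h}(X) |_{h=0} = -U(X)`, `U(X)ᵢ = (sin θᵢ/|k|²) k = u_k(xᵢ)`. [folklore] -/
theorem hasDerivAt_transportFlow_neg_zero (L : ℝ) (n : Fin 3 → ℤ) (X : Config N) :
    HasDerivAt (fun h : ℝ => transportFlow L n (-h) X)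
      (-(fun i => (sin (phase L n X i) / ksq L n) • kvec L n)) 0 := by
  have hg : HasDerivAt (fun t : ℝ => transportFlow L n t X)
      (fun i => (sin (phase L n X i) / ksq L n) • kvec L n) (-0) := by
    simpa only [neg_zero, angleFlow_zero, add_zero] using hasDerivAt_transportFlow_pi L n 0 X
  have h := hg.scomp (0 : ℝ) (hasDerivAt_neg (0 : ℝ))
  rwa [neg_one_smul] at h

/-- `DΦ(X)[U(X)] = ∑ᵢ (sin θᵢ/|k|²) k·∇ᵢΦ(X)` (linearity over the particle blocks). [folklore] -/
theorem fderiv_apply_field (L : ℝ) (n : Fin 3 → ℤ) (φ : Config N → ℂ) (X : Config N) :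
    fderiv ℝ φ X (fun i => (sin (phase L n X i) / ksq L n) • kvec L n) =
      ∑ i, (sin (phase L n X i) / ksq L n) • kDeriv L n φ X i := by
  conv_lhs => rw [← Finset.univ_sum_single (fun i => (sin (phase L n X i) / ksq L n) • kvec L n)]
  rw [map_sum]
  refine Finset.sum_congr rfl fun i _ => ?_
  rw [Pi.single_smul', map_smul]
  rfl

/-- `∂_h |φ(F_{-h} X)|² |_{h=0} = -∑ᵢ (sin θᵢ/|k|²) 2Re(conj φ(X) · k·∇ᵢφ(X))` for `φ ∈ C¹`
(chain rule: `D|φ|²(X)[-U(X)]`). [folklore] -/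
theorem hasDerivAt_norm_sq_comp_transportFlow_neg_zero (L : ℝ) (n : Fin 3 → ℤ) {φ : Config N → ℂ}
    (hφ : ContDiff ℝ 1 φ) (X : Config N) :
    HasDerivAt (fun h : ℝ => ‖φ (transportFlow L n (-h) X)‖ ^ 2)
      (-(∑ i, sin (phase L n X i) / ksq L n * (2 * (conj (φ X) * kDeriv L n φ X i).re))) 0 := by
  have hd : HasFDerivAt φ (fderiv ℝ φ X) X := (hφ.differentiable one_ne_zero X).hasFDerivAt
  have h : HasDerivAt (fun h : ℝ => ‖φ (transportFlow L n (-h) X)‖ ^ 2)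
      ((2 • (innerSL ℝ (φ X)).comp (fderiv ℝ φ X))
        (-(fun i => (sin (phase L n X i) / ksq L n) • kvec L n))) 0 :=
    hd.norm_sq.comp_hasDerivAt_of_eq 0 (hasDerivAt_transportFlow_neg_zero L n X)
      (by rw [neg_zero, transportFlow_zero])
  refine h.congr_deriv ?_
  simp only [FunLike.coe_smul, Pi.smul_apply, ContinuousLinearMap.coe_comp,
    Function.comp_apply, map_neg, innerSL_apply_apply, fderiv_apply_field, inner_sum,
    real_inner_smul_right, Complex.inner, nsmul_eq_mul, Nat.cast_ofNat, Finset.mul_sum, neg_inj]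
  refine Finset.sum_congr rfl fun i _ => ?_
  rw [mul_comm (kDeriv L n φ X i)]
  ring

/-- `∂_h J_h(X)² |_{h=0} = ∂_h ∏ᵢ (cosh h + cos θᵢ sinh h)⁻¹ |_{h=0} = -∑ᵢ cos θᵢ`
(`= -½·2 div U`: the half-density Jacobian factor squared). [folklore] -/
theorem hasDerivAt_transportWeight_sq_zero (L : ℝ) (n : Fin 3 → ℤ) (X : Config N) :
    HasDerivAt (fun h : ℝ => ∏ i, (cosh h + cos (phase L n X i) * sinh h)⁻¹)
      (-(∑ i, cos (phase L n X i))) 0 := by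
  have hf : ∀ i ∈ (Finset.univ : Finset (Fin N)),
      HasDerivAt (fun h : ℝ => (cosh h + cos (phase L n X i) * sinh h)⁻¹)
        (-cos (phase L n X i)) 0 := by
    intro i _
    have h1 : HasDerivAt (fun h : ℝ => cosh h + cos (phase L n X i) * sinh h)
        (sinh 0 + cos (phase L n X i) * cosh 0) 0 :=
      (hasDerivAt_cosh 0).add ((hasDerivAt_sinh 0).const_mul _)
    have h2 : HasDerivAt (fun h : ℝ => (cosh h + cos (phase L n X i) * sinh h)⁻¹)
        (-(sinh 0 + cos (phase L n X i) * cosh 0) / (cosh 0 + cos (phase L n X i) * sinh 0) ^ 2)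
        0 := h1.fun_inv (by simp)
    refine h2.congr_deriv ?_
    simp
  have h : HasDerivAt (fun h : ℝ => ∏ i, (cosh h + cos (phase L n X i) * sinh h)⁻¹)
      (∑ i, (∏ j ∈ Finset.univ.erase i, (cosh (0 : ℝ) + cos (phase L n X j) * sinh 0)⁻¹) •
        -cos (phase L n X i)) 0 := HasDerivAt.fun_finsetProd hf
  refine h.congr_deriv ?_
  simp

/-- **THE CONTINUITY EQUATION AT `τ = 0`**: for `φ ∈ C¹`,
`∂_h |transportFun h φ (X)|² |_{h=0} = -∑ᵢ [cos θᵢ |φ(X)|² + (sin θᵢ/|k|²) 2Re(conj φ(X) k·∇ᵢφ(X))]`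
(`= -div_X(|φ|² U)(X)`; product rule for `|φ(F_{-h}X)|² · J_h(X)²`). [folklore] -/
theorem hasDerivAt_norm_sq_transportFun_zero (L : ℝ) (n : Fin 3 → ℤ) {φ : Config N → ℂ}
    (hφ : ContDiff ℝ 1 φ) (X : Config N) :
    HasDerivAt (fun h : ℝ => ‖transportFun L n h φ X‖ ^ 2)
      (-(∑ i, (cos (phase L n X i) * ‖φ X‖ ^ 2 +
        sin (phase L n X i) / ksq L n * (2 * (conj (φ X) * kDeriv L n φ X i).re)))) 0 := by
  simp_rw [norm_sq_transportFun]
  refine ((hasDerivAt_norm_sq_comp_transportFlow_neg_zero L n hφ X).mul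
    (hasDerivAt_transportWeight_sq_zero L n X)).congr_deriv ?_
  simp only [neg_zero, transportFlow_zero, cosh_zero, sinh_zero, mul_zero, add_zero, inv_one,
    Finset.prod_const_one, mul_one]
  rw [Finset.sum_add_distrib, mul_neg, Finset.mul_sum]
  have hc : ∑ i, ‖φ X‖ ^ 2 * cos (phase L n X i) = ∑ i, cos (phase L n X i) * ‖φ X‖ ^ 2 :=
    Finset.sum_congr rfl fun i _ => mul_comm _ _
  rw [hc]
  ring

/-- **THE CONTINUITY EQUATION ALONG THE TRANSPORT**: for `ψ ∈ C¹`, `|k|² ≠ 0` and every `τ`, `X`,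
`∂_τ |Φ^τ(X)|² = -∑ᵢ [cos θᵢ |Φ^τ(X)|² + (sin θᵢ/|k|²) 2Re(conj Φ^τ(X) · k·∇ᵢΦ^τ(X))]`
(the case `τ = 0` transported by the group law `Φ^t = (Φ^τ)^{t-τ}`). [folklore] -/
theorem hasDerivAt_norm_sq_transportFun (hk : ksq L n ≠ 0) {ψ : Config N → ℂ}
    (hψ : ContDiff ℝ 1 ψ) (τ : ℝ) (X : Config N) :
    HasDerivAt (fun t : ℝ => ‖transportFun L n t ψ X‖ ^ 2)
      (-(∑ i, (cos (phase L n X i) * ‖transportFun L n τ ψ X‖ ^ 2 +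
        sin (phase L n X i) / ksq L n *
          (2 * (conj (transportFun L n τ ψ X) * kDeriv L n (transportFun L n τ ψ) X i).re)))) τ := by
  have h0 := hasDerivAt_norm_sq_transportFun_zero L n (contDiff_transportFun L n τ hψ) X
  have h1 := HasDerivAt.comp_sub_const τ τ (f := fun h : ℝ =>
    ‖transportFun L n h (transportFun L n τ ψ) X‖ ^ 2) (by rw [sub_self]; exact h0)
  refine h1.congr_of_eventuallyEq (Eventually.of_forall fun t => ?_)
  show ‖transportFun L n t ψ X‖ ^ 2 = ‖transportFun L n (t - τ) (transportFun L n τ ψ) X‖ ^ 2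
  rw [transportFun_transportFun hk, sub_add_cancel]

/-- The modulated momentum density along the transport is a partial derivative of the jointly
`C¹` map `(t, X) ↦ Φ^t(X)`: `k·∇ᵢΦ^t(X) = D[(t,X) ↦ Φ^t(X)](t, X)[(0, k eᵢ)]`. [folklore] -/
theorem kDeriv_transportFun_eq_fderiv_uncurry (L : ℝ) (n : Fin 3 → ℤ) {ψ : Config N → ℂ}
    (hψ : ContDiff ℝ 1 ψ) (t : ℝ) (X : Config N) (i : Fin N) :
    kDeriv L n (transportFun L n t ψ) X i =
      fderiv ℝ (fun p : ℝ × Config N => transportFun L n p.1 ψ p.2) (t, X)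
        ((0 : ℝ), Pi.single i (kvec L n)) := by
  have hf : HasFDerivAt (fun p : ℝ × Config N => transportFun L n p.1 ψ p.2)
      (fderiv ℝ (fun p : ℝ × Config N => transportFun L n p.1 ψ p.2) (t, X)) (t, X) :=
    ((contDiff_transportFun_uncurry L n hψ).differentiable one_ne_zero (t, X)).hasFDerivAt
  have hc : HasFDerivAt (transportFun L n t ψ)
      ((fderiv ℝ (fun p : ℝ × Config N => transportFun L n p.1 ψ p.2) (t, X)).comp
        (ContinuousLinearMap.inr ℝ ℝ (Config N))) X :=
    hf.comp X (hasFDerivAt_prodMk_right t X)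
  rw [kDeriv, hc.fderiv]
  rfl

/-- Joint continuity of `(t, X) ↦ k·∇ᵢΦ^t(X)` for `ψ ∈ C¹`. [folklore] -/
theorem continuous_kDeriv_transportFun_uncurry (L : ℝ) (n : Fin 3 → ℤ) {ψ : Config N → ℂ}
    (hψ : ContDiff ℝ 1 ψ) (i : Fin N) :
    Continuous fun p : ℝ × Config N => kDeriv L n (transportFun L n p.1 ψ) p.2 i := by
  simp_rw [kDeriv_transportFun_eq_fderiv_uncurry L n hψ, Prod.mk.eta]
  exact ((contDiff_transportFun_uncurry L n hψ).continuous_fderiv one_ne_zero).clm_apply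
    continuous_const

/-- Joint continuity in `(t, X)` of the virial density
`∑ᵢ [cos θᵢ |Φ^t(X)|² + (sin θᵢ/|k|²) 2Re(conj Φ^t(X) · k·∇ᵢΦ^t(X))]` for `ψ ∈ C¹`. [folklore] -/
theorem continuous_virialDensity_uncurry (L : ℝ) (n : Fin 3 → ℤ) {ψ : Config N → ℂ}
    (hψ : ContDiff ℝ 1 ψ) :
    Continuous fun p : ℝ × Config N => ∑ i, (cos (phase L n p.2 i) * ‖transportFun L n p.1 ψ p.2‖ ^ 2 +
      sin (phase L n p.2 i) / ksq L n *
        (2 * (conj (transportFun L n p.1 ψ p.2) * kDeriv L n (transportFun L n p.1 ψ) p.2 i).re)) := by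
  have hT : Continuous fun p : ℝ × Config N => transportFun L n p.1 ψ p.2 :=
    (contDiff_transportFun_uncurry L n hψ).continuous
  refine continuous_finsetSum _ fun i _ => ?_
  have hph : Continuous fun p : ℝ × Config N => phase L n p.2 i :=
    (continuous_phase L n i).comp continuous_snd
  exact ((continuous_cos.comp hph).mul (hT.norm.pow 2)).add
    (((continuous_sin.comp hph).div_const _).mul (continuous_const.mul
      (Complex.continuous_re.comp ((Complex.continuous_conj.comp hT).mul
        (continuous_kDeriv_transportFun_uncurry L n hψ i)))))

/-! ### Bounded pair potentials: the interaction is bounded on configuration space -/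

/-- Counting lattice images: a profile bounded by `B ≥ 0` and vanishing beyond `R ≥ 0` has
`w^per ≤ B |B₁| (R/L + 1)³` (comparison with the periodised square well `B·1_{r ≤ R}`,
`periodizedPotential_sqWell_le`). [folklore] -/
theorem periodizedPotential_le_of_bounded {w : ℝ → ℝ≥0∞} {B R : ℝ} (hB : 0 ≤ B) (hR : 0 ≤ R)
    (hL : 0 < L) (hwB : ∀ r, w r ≤ ENNReal.ofReal B) (hwR : ∀ r, R < r → w r = 0) (x : Space) :
    periodizedPotential w L x ≤ ENNReal.ofReal (B * ((R / L + 1) ^ 3 * ω₃)) := by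
  -- adapted from `periodizedPotential_le_of_bound`
  -- (Theorems/BECConjugateDominationInfraredMinimumUncertaintyWeakEulerLagrange.lean)
  refine le_trans ?_ (periodizedPotential_sqWell_le hB hR hL x)
  unfold periodizedPotential
  refine ENNReal.tsum_le_tsum fun m => ?_
  by_cases h : ‖x - latticeVec L m‖ ≤ R
  · rw [show sqWell B R ‖x - latticeVec L m‖ = ENNReal.ofReal B from
      Set.indicator_of_mem (Set.mem_Iic.2 h) _]
    exact hwB _
  · rw [hwR _ (lt_of_not_ge h)]
    exact bot_le

/-- A BOUNDED admissible pair potential has a bounded periodic interaction: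
`∑_{i<j} w^per(xᵢ - xⱼ) ≤ C < ∞` uniformly in the configuration. [folklore] -/
theorem exists_periodicInteraction_le_ofReal {w : ℝ → ℝ≥0∞} (hw : IsRepulsiveFiniteRange w)
    {B : ℝ} (hB : ∀ r, w r ≤ ENNReal.ofReal B) (hL : 0 < L) (N : ℕ) :
    ∃ C : ℝ, 0 ≤ C ∧ ∀ X : Config N, periodicInteraction w L X ≤ ENNReal.ofReal C := by
  obtain ⟨R₀, hR₀⟩ := hw.2
  have hB' : ∀ r, w r ≤ ENNReal.ofReal (max B 0) := fun r =>
    (hB r).trans (ENNReal.ofReal_le_ofReal (le_max_left _ _))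
  have hR' : ∀ r, max R₀ 0 < r → w r = 0 := fun r hr => hR₀ r ((le_max_left _ _).trans_lt hr)
  have hω := ω₃_nonneg
  have hb : 0 ≤ max B 0 * ((max R₀ 0 / L + 1) ^ 3 * ω₃) := by positivity
  refine ⟨pairCount N * (max B 0 * ((max R₀ 0 / L + 1) ^ 3 * ω₃)), by positivity, fun X => ?_⟩
  calc periodicInteraction w L X
      ≤ (pairCount N : ℝ≥0∞) * ENNReal.ofReal (max B 0 * ((max R₀ 0 / L + 1) ^ 3 * ω₃)) :=
        periodicInteraction_le_of_le
          (periodizedPotential_le_of_bounded (le_max_right _ _) (le_max_right _ _) hL hB' hR') X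
    _ = ENNReal.ofReal (pairCount N * (max B 0 * ((max R₀ 0 / L + 1) ^ 3 * ω₃))) := by
        rw [ENNReal.ofReal_mul (Nat.cast_nonneg _), ENNReal.ofReal_natCast]

/-- The periodic interaction of a measurable profile is measurable. [folklore] -/
theorem measurable_periodicInteraction_cfg {w : ℝ → ℝ≥0∞} (hw : Measurable w) (L : ℝ) :
    Measurable fun X : Config N => periodicInteraction w L X := by
  -- adapted from `measurable_periodicInteraction_bf` (Literature/.../BosonicFloor.lean)
  have hp : Measurable (periodizedPotential w L) := by
    unfold periodizedPotential
    exact Measurable.tsum fun m => hw.comp (measurable_id.sub_const _).norm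
  unfold periodicInteraction
  refine Finset.measurable_sum _ fun i _ => Finset.measurable_sum _ fun j _ => ?_
  exact hp.comp ((measurable_pi_apply i).sub (measurable_pi_apply j))

/-- A bounded interaction times a continuous function is integrable on the cell. [folklore] -/
theorem integrableOn_toReal_interaction_mul_of_le {w : ℝ → ℝ≥0∞} (hwm : Measurable w) {C : ℝ}
    (hC0 : 0 ≤ C) (hC : ∀ X : Config N, periodicInteraction w L X ≤ ENNReal.ofReal C)
    {g : Config N → ℝ} (hg : Continuous g) :
    IntegrableOn (fun X => (periodicInteraction w L X).toReal * g X) (cellN N L) := by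
  refine Integrable.bdd_mul (c := C) (integrableOn_cellN hg L)
    (measurable_periodicInteraction_cfg hwm L).ennreal_toReal.aestronglyMeasurable
    (ae_of_all _ fun X => ?_)
  rw [Real.norm_of_nonneg ENNReal.toReal_nonneg]
  exact ENNReal.toReal_le_of_le_ofReal hC0 (hC X)

/-! ### The interaction variation `d/dτ ∫ W|Φ^τ|² = -I_k(Φ^τ)` -/

/-- **INTERACTION VARIATION** for a BOUNDED admissible pair potential:
`d/dτ ∫_cell W |Φ^τ|² = -I_k(Φ^τ)`, `W = ∑_{i<j} w^per(xᵢ - xⱼ)` (only measurable: the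
derivative falls on `|Φ^τ|²` through the continuity equation; dominated differentiation under
the integral, the derivative density being bounded on `[τ-1, τ+1] × cell` by joint continuity
and `W` being bounded). [folklore] -/
theorem hasDerivAt_interaction_transport {w : ℝ → ℝ≥0∞} (hw : IsRepulsiveFiniteRange w) {B : ℝ}
    (hB : ∀ r, w r ≤ ENNReal.ofReal B) (hL : 0 < L) (hn : n ≠ 0) (Φ : PeriodicTrialState N L)
    (τ : ℝ) : HasDerivAt (fun t : ℝ => ∫ X in cellN N L,
        (periodicInteraction w L X).toReal * ‖transportFun L n t Φ.ψ X‖ ^ 2)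
      (-(virialWave w n (Φ.transport hL hn τ))) τ := by
  have hk : ksq L n ≠ 0 := (ksq_pos hL.ne' hn).ne'
  obtain ⟨C, hC0, hC⟩ := exists_periodicInteraction_le_ofReal hw hB hL N
  set v : ℝ × Config N → ℝ := fun p => ∑ i, (cos (phase L n p.2 i) * ‖transportFun L n p.1 Φ.ψ p.2‖ ^ 2 +
      sin (phase L n p.2 i) / ksq L n *
        (2 * (conj (transportFun L n p.1 Φ.ψ p.2) * kDeriv L n (transportFun L n p.1 Φ.ψ) p.2 i).re))
    with hv
  have hvc : Continuous v := continuous_virialDensity_uncurry L n Φ.contDiff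
  have hρc : ∀ t : ℝ, Continuous fun X : Config N => ‖transportFun L n t Φ.ψ X‖ ^ 2 := fun t =>
    ((contDiff_transportFun L n t Φ.contDiff).continuous.norm).pow 2
  have hK : IsCompact (Icc (τ - 1) (τ + 1) ×ˢ closedBall (0 : Config N) (2 * |L|)) :=
    isCompact_Icc.prod (isCompact_closedBall _ _)
  obtain ⟨M, hM⟩ := hK.exists_bound_of_continuousOn hvc.continuousOn
  have hWm : AEStronglyMeasurable (fun X : Config N => (periodicInteraction w L X).toReal)
      (volume.restrict (cellN N L)) :=
    (measurable_periodicInteraction_cfg hw.1 L).ennreal_toReal.aestronglyMeasurable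
  have hvτ : Continuous fun X : Config N => -v (τ, X) :=
    (hvc.comp (continuous_const.prodMk continuous_id)).neg
  have hmain := hasDerivAt_integral_of_dominated_loc_of_deriv_le
    (μ := volume.restrict (cellN N L)) (x₀ := τ) (s := ball τ 1)
    (F := fun (t : ℝ) (X : Config N) =>
      (periodicInteraction w L X).toReal * ‖transportFun L n t Φ.ψ X‖ ^ 2)
    (F' := fun (t : ℝ) (X : Config N) => (periodicInteraction w L X).toReal * -v (t, X))
    (bound := fun _ => C * M) (ball_mem_nhds τ one_pos)
    (Eventually.of_forall fun t => hWm.mul (hρc t).aestronglyMeasurable)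
    (integrableOn_toReal_interaction_mul_of_le hw.1 hC0 hC (hρc τ))
    (hWm.mul hvτ.aestronglyMeasurable)
    (by
      filter_upwards [ae_restrict_mem (measurableSet_cellN N L)] with X hX
      intro t ht
      have ht' : t ∈ Icc (τ - 1) (τ + 1) := by
        rw [Real.ball_eq_Ioo] at ht
        exact Ioo_subset_Icc_self ht
      have h1 : (periodicInteraction w L X).toReal ≤ C := ENNReal.toReal_le_of_le_ofReal hC0 (hC X)
      have h2 : ‖v (t, X)‖ ≤ M := hM (t, X) ⟨ht', cellN_subset_closedBall N L hX⟩
      rw [norm_mul, norm_neg, Real.norm_of_nonneg ENNReal.toReal_nonneg]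
      exact mul_le_mul h1 h2 (norm_nonneg _) hC0)
    (integrableOn_cellN continuous_const L)
    (Eventually.of_forall fun X t _ =>
      (hasDerivAt_norm_sq_transportFun hk Φ.contDiff t X).const_mul _)
  have hI : ∫ X in cellN N L, (periodicInteraction w L X).toReal * -v (τ, X) =
      -(virialWave w n (Φ.transport hL hn τ)) := by
    rw [virialWave, ← integral_neg]
    refine integral_congr_ae (Eventually.of_forall fun X => ?_)
    simp only [hv, PeriodicTrialState.transport_ψ, mul_neg]
  rw [← hI]
  exact hmain.2

/-! ### The registered sub-goal -/

/-- **Registered sub-goal `stub_transportVariations` of S1** (line `force-balance-constitutive`,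
crux stmt-AtomisticToContinuum-9481): for a bounded admissible pair potential `w`, `L > 0`, a mode
`n ≠ 0` and an admissible periodic state `Φ`, along the transport `τ ↦ Φ^τ = Φ.transport hL hn τ`
the density wave has derivative `d/dτ m(Φ^τ) = -N_eff(Φ^τ)` and the interaction energy has
derivative `d/dτ ∫_cell W|Φ^τ|² = -I_k(Φ^τ)` (the virial wave). [folklore] -/
theorem stub_transportVariations : ∀ (N : ℕ) (L : ℝ) (n : Fin 3 → ℤ) (w : ℝ → ENNReal) (B : ℝ)
    (hL : 0 < L) (hn : n ≠ 0),
    Literature.MathematicalPhysics.QuantumManyBody.BoseGas.IsRepulsiveFiniteRange w →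
    (∀ r : ℝ, w r ≤ ENNReal.ofReal B) →
    ∀ (Φ : Literature.MathematicalPhysics.QuantumManyBody.BoseGas.PeriodicTrialState N L) (τ : ℝ),
    HasDerivAt (fun t : ℝ => sourceMean n (Φ.transport hL hn t))
      (-(effNumber n (Φ.transport hL hn τ))) τ ∧
    HasDerivAt (fun t : ℝ => ∫ X in Literature.MathematicalPhysics.QuantumManyBody.BoseGas.cellN N L,
        (Literature.MathematicalPhysics.QuantumManyBody.BoseGas.periodicInteraction w L X).toReal *
          ‖transportFun L n t Φ.ψ X‖ ^ 2)
      (-(virialWave w n (Φ.transport hL hn τ))) τ :=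
  fun _ _ _ _ _ hL hn hw hB Φ τ =>
    ⟨hasDerivAt_sourceMean_transport hL hn Φ τ, hasDerivAt_interaction_transport hw hB hL hn Φ τ⟩

end

end Summit.AtomisticToContinuum.BoseEinsteinCondensation.Cruxes.DensityResponse.ForceBalanceConstitutive
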